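import Literature.MathematicalPhysics.QuantumManyBody.BoseGasFaceHardy
import Literature.MathematicalPhysics.QuantumManyBody.GroundState
import Literature.Analysis.FunctionSpaces.SobolevDomainProofs
import HarnessLib

/-!
# `L²`-compactness of Dirichlet trial states with bounded kinetic energy, and limits at a face

Topic `Literature/MathematicalPhysics/QuantumManyBody`, grouping namespace `BoseGas.BoxFace`, sequel
of `BoseGasFaceHardy.lean`. Compactness plumbing for Dirichlet problems in boxes (used by
`BoseGasEnergyRightContinuity.lean`; reusable for ground-state existence by compactness):

* `BoxFace.enorm_fderiv_sq_le` — the operator norm of the derivative is controlled by the kinetic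
  density, `‖DΨ(X)‖² ≤ 3N · kineticDensity Ψ X` (the sup norm of `(ℝ³)^N` against the coordinate
  directions of `kineticDensity`; Cauchy–Schwarz);
* `BoxFace.exists_subseq_tendsto_of_trialStates` — **Rellich for trial states**: Dirichlet trial
  states `Φₙ` of boxes `Λ_{Lₙ}`, `0 ≤ Lₙ ≤ L̄`, with `∫|∇Φₙ|² ≤ K < ∞` have a subsequence converging
  in `L²((ℝ³)^N)` AND almost everywhere to some `f ∈ L²` (the tree's `C¹`-core Rellich–Kondrachov
  theorem `Literature.Analysis.FunctionSpaces.exists_subseq_tendsto_eLpNorm_of_contDiff` — Evans,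
  *PDE*, §5.7 Thm 1 — then a further a.e.-convergent subsequence);
* `BoxFace.ae_eq_zero_of_tendsto_face` — the a.e. limit vanishes a.e. beyond the limiting face;
* `BoxFace.lintegral_sq_div_sq_limit_le` — **the weighted Hardy bound survives the limit**: if
  `Φₙ → f` a.e., `Φₙ = 0` where `X_p ≥ bₙ`, `bₙ → b`, `bₙ ≥ b`, and `∫ ‖∂_pΦₙ‖² ≤ K`, then
  `∫_{b-ℓ<X_p<b} ‖f‖²/(b - X_p)² ≤ 4K` (Hardy at the faces `bₙ`, Fatou);
* `BoxFace.volume_coord_eq_zero` — coordinate hyperplanes are Lebesgue-null;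
* `BoxFace.tendsto_setLIntegral_sq` — `L²` convergence gives convergence of the mass of every set.

Tagged folklore (Evans §5.7 for the compactness theorem, which is the tree's). Not here: weak
derivatives of the limit, `H¹₀` membership, lower semicontinuity of the energy.

## References

* L. C. Evans, *Partial Differential Equations*, 2nd ed. (2010), §5.7 Thm 1. [Evans2010]
-/

noncomputable section

namespace Literature.MathematicalPhysics.QuantumManyBody.BoseGas

open _root_.MeasureTheory _root_.Filter _root_.Set
open scoped ENNReal NNReal Topology

namespace BoxFace

variable {N : ℕ}

/-! ### The derivative against the kinetic density -/

/-- Every vector of `(ℝ³)^N` is the sum of its coordinates times the coordinate vectors. [folklore] -/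
theorem sum_smul_coordVec (H : Config N) :
    ∑ p : Fin N × Fin 3, H p.1 p.2 • (Pi.single p.1 (EuclideanSpace.single p.2 (1 : ℝ)) : Config N) = H := by
  ext j m
  have h1 : (∑ p : Fin N × Fin 3, H p.1 p.2 •
      (Pi.single p.1 (EuclideanSpace.single p.2 (1 : ℝ)) : Config N)) j m =
      ∑ p : Fin N × Fin 3, H p.1 p.2 *
        (Pi.single p.1 (EuclideanSpace.single p.2 (1 : ℝ)) : Config N) j m := by
    rw [Finset.sum_apply, WithLp.ofLp_sum, Finset.sum_apply]
    simp only [Pi.smul_apply, WithLp.ofLp_smul, smul_eq_mul]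
  rw [h1]
  simp only [coordVec_apply, mul_ite, mul_one, mul_zero]
  rw [Fintype.sum_prod_type, Finset.sum_eq_single_of_mem j (Finset.mem_univ j)
    (fun x _ hx => Finset.sum_eq_zero fun y _ => if_neg fun h => hx h.1.symm),
    Finset.sum_eq_single_of_mem m (Finset.mem_univ m) (fun y _ hy => if_neg fun h => hy h.2.symm),
    if_pos ⟨rfl, rfl⟩]

/-- A coordinate is bounded by the (sup-Euclidean) norm of `(ℝ³)^N`. [folklore] -/
theorem norm_coord_le (H : Config N) (p : Fin N × Fin 3) : ‖H p.1 p.2‖ ≤ ‖H‖ :=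
  (PiLp.norm_apply_le (H p.1) p.2).trans (norm_le_pi_norm H p.1)

/-- The operator norm of a functional on `(ℝ³)^N` is at most the sum of its values on the
coordinate vectors. [folklore] -/
theorem opNorm_le_sum_coordVec {F : Type*} [NormedAddCommGroup F] [NormedSpace ℝ F]
    (T : Config N →L[ℝ] F) :
    ‖T‖ ≤ ∑ p : Fin N × Fin 3, ‖T (Pi.single p.1 (EuclideanSpace.single p.2 (1 : ℝ)))‖ := by
  refine ContinuousLinearMap.opNorm_le_bound _ (Finset.sum_nonneg fun _ _ => norm_nonneg _)
    fun H => ?_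
  conv_lhs => rw [← sum_smul_coordVec H]
  rw [map_sum, Finset.sum_mul]
  refine (norm_sum_le _ _).trans (Finset.sum_le_sum fun p _ => ?_)
  rw [map_smul, norm_smul, mul_comm]
  exact mul_le_mul_of_nonneg_left (norm_coord_le H p) (norm_nonneg _)

/-- **The derivative is controlled by the kinetic density**: `‖DΨ(X)‖² ≤ 3N · |∇Ψ|²(X)`
(Cauchy–Schwarz over the `3N` coordinate directions). [folklore] -/
theorem enorm_fderiv_sq_le (ψ : Config N → ℂ) (X : Config N) :
    ‖fderiv ℝ ψ X‖ₑ ^ 2 ≤ (3 * N : ℝ≥0∞) * kineticDensity ψ X := by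
  set T := fderiv ℝ ψ X
  have hreal : ‖T‖ ^ 2 ≤ (3 * N : ℝ) *
      ∑ p : Fin N × Fin 3, ‖T (Pi.single p.1 (EuclideanSpace.single p.2 (1 : ℝ)))‖ ^ 2 := by
    calc ‖T‖ ^ 2 ≤ (∑ p : Fin N × Fin 3, ‖T (Pi.single p.1 (EuclideanSpace.single p.2 (1 : ℝ)))‖) ^ 2 :=
          pow_le_pow_left₀ (norm_nonneg _) (opNorm_le_sum_coordVec T) 2
      _ ≤ (Finset.univ : Finset (Fin N × Fin 3)).card *
            ∑ p : Fin N × Fin 3, ‖T (Pi.single p.1 (EuclideanSpace.single p.2 (1 : ℝ)))‖ ^ 2 :=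
          sq_sum_le_card_mul_sum_sq
      _ = _ := by
          rw [Finset.card_univ, Fintype.card_prod, Fintype.card_fin, Fintype.card_fin, Nat.cast_mul,
            Nat.cast_ofNat, mul_comm (N : ℝ) 3]
  have hkin : kineticDensity ψ X = ENNReal.ofReal
      (∑ p : Fin N × Fin 3, ‖T (Pi.single p.1 (EuclideanSpace.single p.2 (1 : ℝ)))‖ ^ 2) := by
    unfold kineticDensity
    rw [ENNReal.ofReal_sum_of_nonneg (fun _ _ => sq_nonneg _), Fintype.sum_prod_type]
    refine Finset.sum_congr rfl fun i _ => Finset.sum_congr rfl fun k _ => ?_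
    rw [← ENNReal.coe_pow, ← ENNReal.ofReal_coe_nnreal, NNReal.coe_pow, coe_nnnorm]
  rw [hkin, ← ofReal_norm, ← ENNReal.ofReal_pow (norm_nonneg _),
    show (3 * N : ℝ≥0∞) = ENNReal.ofReal (3 * N) by
      rw [ENNReal.ofReal_mul (by norm_num), ENNReal.ofReal_ofNat, ENNReal.ofReal_natCast],
    ← ENNReal.ofReal_mul (by positivity)]
  exact ENNReal.ofReal_le_ofReal hreal

/-- The `L²` norm of the derivative is at most `(3N ∫|∇Ψ|²)^{1/2}`. [folklore] -/
theorem eLpNorm_fderiv_le (ψ : Config N → ℂ) :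
    eLpNorm (fderiv ℝ ψ) 2 volume ≤ ((3 * N : ℝ≥0∞) * ∫⁻ X, kineticDensity ψ X) ^ (1 / 2 : ℝ) := by
  rw [eLpNorm_eq_lintegral_rpow_enorm_toReal two_ne_zero ENNReal.ofNat_ne_top, ENNReal.toReal_ofNat,
    ← lintegral_const_mul' _ _ (by
      exact ENNReal.mul_ne_top (by norm_num) (ENNReal.natCast_ne_top N))]
  gcongr with X
  rw [ENNReal.rpow_two]
  exact enorm_fderiv_sq_le ψ X

/-! ### Rellich for trial states -/

/-- The `N`-particle box lies in the closed ball of radius `2|L|` of `(ℝ³)^N`. [folklore] -/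
theorem boxN_subset_closedBall (N : ℕ) (L : ℝ) :
    boxN N L ⊆ Metric.closedBall (0 : Config N) (2 * |L|) := by
  intro X hX
  rw [Metric.mem_closedBall, dist_zero_right, pi_norm_le_iff_of_nonneg (by positivity)]
  intro i
  rw [EuclideanSpace.norm_eq]
  have hk : ∀ k, ‖X i k‖ ^ 2 ≤ |L| ^ 2 := fun k => by
    have h := hX i k
    rw [Real.norm_eq_abs]
    exact pow_le_pow_left₀ (abs_nonneg _) (by rw [abs_of_pos h.1]; exact h.2.le.trans (le_abs_self L)) 2
  calc Real.sqrt (∑ k, ‖X i k‖ ^ 2) ≤ Real.sqrt ((2 * |L|) ^ 2) := by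
        refine Real.sqrt_le_sqrt ((Finset.sum_le_sum fun k _ => hk k).trans ?_)
        simp only [Finset.sum_const, Finset.card_univ, Fintype.card_fin, nsmul_eq_mul]
        push_cast
        nlinarith [sq_nonneg |L|]
    _ = 2 * |L| := Real.sqrt_sq (by positivity)

/-- The closed support of a Dirichlet wave function of the box `Λ_L` lies in the closed ball of
radius `2|L|`. [folklore] -/
theorem tsupport_subset_closedBall {L : ℝ} {ψ : Config N → ℂ} (h0 : ∀ X, X ∉ boxN N L → ψ X = 0) :
    tsupport ψ ⊆ Metric.closedBall (0 : Config N) (2 * |L|) := by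
  refine closure_minimal (fun X hX => boxN_subset_closedBall N L ?_) Metric.isClosed_closedBall
  by_contra h
  exact hX (h0 X h)

/-- **Rellich–Kondrachov for Dirichlet trial states.** Trial states `Φₙ` of boxes `Λ_{Lₙ}` with
`Lₙ ≤ L̄` and kinetic energies `≤ K < ∞` have a subsequence converging in `L²((ℝ³)^N)` and almost
everywhere to some `f ∈ L²`. Evans, *PDE*, §5.7 Thm 1 (through the tree's `C¹`-core form
`exists_subseq_tendsto_eLpNorm_of_contDiff`), plus a further a.e.-convergent subsequence.
[folklore] -/
theorem exists_subseq_tendsto_of_trialStates (L : ℕ → ℝ) {Lbar : ℝ} (hL0 : ∀ n, 0 ≤ L n)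
    (hL : ∀ n, L n ≤ Lbar)
    (Φ : (n : ℕ) → TrialState N (L n)) {K : ℝ≥0∞} (hK : K ≠ ⊤)
    (hkin : ∀ n, ∫⁻ X, kineticDensity (Φ n).ψ X ≤ K) :
    ∃ (f : Config N → ℂ) (κ : ℕ → ℕ), StrictMono κ ∧ MemLp f 2 volume ∧
      Tendsto (fun n => eLpNorm ((Φ (κ n)).ψ - f) 2 volume) atTop (𝓝 0) ∧
      ∀ᵐ X : Config N, Tendsto (fun n => (Φ (κ n)).ψ X) atTop (𝓝 (f X)) := by
  have hsupp : ∀ n, tsupport (Φ n).ψ ⊆ Metric.closedBall (0 : Config N) (2 * |Lbar|) := by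
    intro n
    refine (tsupport_subset_closedBall (Φ n).eq_zero).trans (Metric.closedBall_subset_closedBall ?_)
    rw [abs_of_nonneg (hL0 n), abs_of_nonneg ((hL0 n).trans (hL n))]
    linarith [hL n]
  have hA : ∀ n, eLpNorm (Φ n).ψ 2 volume ≤ 1 := fun n => by
    rw [eLpNorm_two_eq_rpow, (Φ n).norm_eq, ENNReal.one_rpow]
  have hB : ∀ n, eLpNorm (fderiv ℝ (Φ n).ψ) 2 volume ≤ ((3 * N : ℝ≥0∞) * K) ^ (1 / 2 : ℝ) :=
    fun n => (eLpNorm_fderiv_le (Φ n).ψ).trans (by gcongr; exact hkin n)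
  have hBtop : ((3 * N : ℝ≥0∞) * K) ^ (1 / 2 : ℝ) ≠ ⊤ :=
    ENNReal.rpow_ne_top_of_nonneg (by norm_num)
      (ENNReal.mul_ne_top (ENNReal.mul_ne_top (by norm_num) (ENNReal.natCast_ne_top N)) hK)
  obtain ⟨f, ψ₁, hψ₁, hf, hlim⟩ :=
    Literature.Analysis.FunctionSpaces.exists_subseq_tendsto_eLpNorm_of_contDiff
      (volume : Measure (Config N)) (p := 2) (by norm_num) (isCompact_closedBall 0 (2 * |Lbar|))
      (fun n => (Φ n).ψ) (fun n => (Φ n).contDiff) hsupp ENNReal.one_ne_top hBtop hA hB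
  have hmeas : TendstoInMeasure volume (fun n => (Φ (ψ₁ n)).ψ) atTop f :=
    tendstoInMeasure_of_tendsto_eLpNorm two_ne_zero
      (fun n => (Φ (ψ₁ n)).contDiff.continuous.aestronglyMeasurable) hf.1 hlim
  obtain ⟨ns, hns, hae⟩ := hmeas.exists_seq_tendsto_ae
  exact ⟨f, ψ₁ ∘ ns, hψ₁.comp hns, hf, hlim.comp hns.tendsto_atTop, hae⟩

/-! ### Limits at a face -/

/-- **The a.e. limit vanishes beyond the limiting face**: if `Φₙ → f` a.e., `Φₙ = 0` where
`X_p ≥ bₙ` and `bₙ → b`, then `f = 0` a.e. on `{b < X_p}`. [folklore] -/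
theorem ae_eq_zero_of_tendsto_face {Φ : ℕ → Config N → ℂ} {f : Config N → ℂ}
    (p : Fin N × Fin 3) {b : ℕ → ℝ} {b₀ : ℝ} (hb : Tendsto b atTop (𝓝 b₀))
    (h0 : ∀ n X, b n ≤ X p.1 p.2 → Φ n X = 0)
    (hae : ∀ᵐ X : Config N, Tendsto (fun n => Φ n X) atTop (𝓝 (f X))) :
    ∀ᵐ X : Config N, b₀ < X p.1 p.2 → f X = 0 := by
  filter_upwards [hae] with X hX hlt
  have hev : ∀ᶠ n in atTop, Φ n X = 0 :=
    (hb.eventually (gt_mem_nhds hlt)).mono fun n hn => h0 n X hn.le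
  exact tendsto_nhds_unique hX (tendsto_const_nhds.congr' (hev.mono fun n hn => hn.symm))

/-- **The weighted Hardy bound survives the limit.** If `Φₙ` are `C¹`, `Φₙ = 0` where `X_p ≥ bₙ`,
`bₙ → b` with `bₙ ≥ b`, `Φₙ → f` a.e., and `∫ ‖∂_pΦₙ‖² ≤ K` for all `n`, then
`∫_{b-ℓ<X_p<b} ‖f‖²/(b - X_p)² ≤ 4K` (Hardy's inequality at the faces `bₙ`,
`lintegral_sq_div_sq_le_right`, and Fatou's lemma). [folklore] -/
theorem lintegral_sq_div_sq_limit_le {Φ : ℕ → Config N → ℂ} (hΦ : ∀ n, ContDiff ℝ 1 (Φ n))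
    {f : Config N → ℂ} (p : Fin N × Fin 3) {b : ℕ → ℝ} {b₀ : ℝ} (hb : Tendsto b atTop (𝓝 b₀))
    (hbb : ∀ n, b₀ ≤ b n) (h0 : ∀ n X, b n ≤ X p.1 p.2 → Φ n X = 0)
    (hae : ∀ᵐ X : Config N, Tendsto (fun n => Φ n X) atTop (𝓝 (f X))) {K : ℝ≥0∞}
    (hK : ∀ n, ∫⁻ X, ‖fderiv ℝ (Φ n) X (Pi.single p.1 (EuclideanSpace.single p.2 (1 : ℝ)))‖ₑ ^ 2 ≤ K)
    (ℓ : ℝ) :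
    ∫⁻ X in {X : Config N | X p.1 p.2 ∈ Ioo (b₀ - ℓ) b₀},
        ‖f X‖ₑ ^ 2 / ENNReal.ofReal ((b₀ - X p.1 p.2) ^ 2) ≤ 4 * K := by
  set S : Set (Config N) := {X | X p.1 p.2 ∈ Ioo (b₀ - ℓ) b₀} with hS_def
  have hS : MeasurableSet S := measurableSet_slab p _ _
  set F : ℕ → Config N → ℝ≥0∞ := fun n X => ‖Φ n X‖ₑ ^ 2 / ENNReal.ofReal ((b n - X p.1 p.2) ^ 2)
    with hF_def
  have hcoord : Measurable fun X : Config N => X p.1 p.2 := by fun_prop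
  have hFm : ∀ n, Measurable (F n) := fun n =>
    ((Continuous.enorm (hΦ n).continuous).measurable.pow_const 2).div
      (ENNReal.measurable_ofReal.comp ((measurable_const.sub hcoord).pow_const 2))
  -- Hardy for each `Φ n` on the larger slab `{b₀ - ℓ < X_p < b n} ⊇ S`
  have hstep : ∀ n, ∫⁻ X in S, F n X ≤ 4 * K := by
    intro n
    have hsub : S ⊆ {X : Config N | X p.1 p.2 ∈ Ioo (b n - (ℓ + (b n - b₀))) (b n)} := by
      intro X hX
      simp only [hS_def, mem_setOf_eq, mem_Ioo] at hX ⊢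
      exact ⟨by linarith [hX.1], hX.2.trans_le (hbb n)⟩
    calc ∫⁻ X in S, F n X
        ≤ ∫⁻ X in {X : Config N | X p.1 p.2 ∈ Ioo (b n - (ℓ + (b n - b₀))) (b n)}, F n X :=
          lintegral_mono_set hsub
      _ ≤ 4 * ∫⁻ X in {X : Config N | X p.1 p.2 ∈ Ioo (b n - (ℓ + (b n - b₀))) (b n)},
            ‖fderiv ℝ (Φ n) X (Pi.single p.1 (EuclideanSpace.single p.2 (1 : ℝ)))‖ₑ ^ 2 :=
          lintegral_sq_div_sq_le_right (hΦ n) p (h0 n) _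
      _ ≤ 4 * K := by
          gcongr
          exact (setLIntegral_le_lintegral _ _).trans (hK n)
  -- Fatou
  have hfatou : ∫⁻ X in S, liminf (fun n => F n X) atTop ≤ 4 * K :=
    (lintegral_liminf_le' fun n => (hFm n).aemeasurable).trans
      (liminf_le_of_frequently_le' (Frequently.of_forall hstep))
  -- identify the liminf a.e. on `S`
  refine le_trans (le_of_eq ?_) hfatou
  refine lintegral_congr_ae ((ae_restrict_iff' hS).2 ?_)
  filter_upwards [hae] with X hX hXS
  have hlt : X p.1 p.2 < b₀ := hXS.2
  have hden : Tendsto (fun n => ENNReal.ofReal ((b n - X p.1 p.2) ^ 2)) atTop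
      (𝓝 (ENNReal.ofReal ((b₀ - X p.1 p.2) ^ 2))) :=
    ENNReal.tendsto_ofReal ((hb.sub_const _).pow 2)
  have hnum : Tendsto (fun n => ‖Φ n X‖ₑ ^ 2) atTop (𝓝 (‖f X‖ₑ ^ 2)) :=
    ENNReal.Tendsto.pow ((continuous_enorm.tendsto _).comp hX)
  have hpos : ENNReal.ofReal ((b₀ - X p.1 p.2) ^ 2) ≠ 0 :=
    (ENNReal.ofReal_pos.2 (by nlinarith)).ne'
  exact (ENNReal.Tendsto.div hnum (Or.inr hpos) hden (Or.inl ENNReal.ofReal_ne_top)).liminf_eq.symm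

/-- **Coordinate hyperplanes are null**: `vol {X | X_p = c} = 0` (each coordinate line meets the
hyperplane in one point). [folklore] -/
theorem volume_coord_eq_zero (p : Fin N × Fin 3) (c : ℝ) :
    volume {X : Config N | X p.1 p.2 = c} = 0 := by
  have hS : MeasurableSet {X : Config N | X p.1 p.2 = c} :=
    (measurableSet_singleton c).preimage (by fun_prop)
  rw [← nonpos_iff_eq_zero, ← lintegral_indicator_one hS, ← lintegral_zero]
  refine lintegral_le_of_lines ((measurable_const).indicator hS) measurable_const p fun X => ?_
  have h1 : ∀ t : ℝ, ({X : Config N | X p.1 p.2 = c}).indicator (1 : Config N → ℝ≥0∞)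
      (X + (t - X p.1 p.2) • (Pi.single p.1 (EuclideanSpace.single p.2 (1 : ℝ)) : Config N)) =
      ({c} : Set ℝ).indicator 1 t := by
    intro t
    by_cases ht : t = c
    · rw [indicator_of_mem (by simpa only [mem_setOf_eq, lineAt_apply_same] using ht),
        indicator_of_mem (by simpa using ht)]; rfl
    · rw [indicator_of_notMem (by simpa only [mem_setOf_eq, lineAt_apply_same] using ht),
        indicator_of_notMem (by simpa using ht)]
  simp_rw [h1]
  rw [lintegral_indicator_one (measurableSet_singleton c), Real.volume_singleton, lintegral_zero]

/-- The mass of a set is the square of the restricted `L²` norm. [folklore] -/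
theorem setLIntegral_enorm_sq_eq (g : Config N → ℂ) (U : Set (Config N)) :
    ∫⁻ X in U, ‖g X‖ₑ ^ 2 = eLpNorm g 2 (volume.restrict U) ^ 2 := by
  rw [eLpNorm_eq_lintegral_rpow_enorm_toReal two_ne_zero ENNReal.ofNat_ne_top, ENNReal.toReal_ofNat,
    Literature.Analysis.Calculus.rpow_half_sq]
  simp_rw [ENNReal.rpow_two]

/-- **`L²` convergence gives convergence of the mass of every set**: if `gₙ → f` in `L²` then
`∫_U |gₙ|² → ∫_U |f|²` for every measurable `U`. [folklore] -/
theorem tendsto_setLIntegral_sq {g : ℕ → Config N → ℂ} {f : Config N → ℂ}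
    (hg : ∀ n, AEStronglyMeasurable (g n) volume) (hf : MemLp f 2 volume)
    (hlim : Tendsto (fun n => eLpNorm (g n - f) 2 volume) atTop (𝓝 0)) (U : Set (Config N)) :
    Tendsto (fun n => ∫⁻ X in U, ‖g n X‖ₑ ^ 2) atTop (𝓝 (∫⁻ X in U, ‖f X‖ₑ ^ 2)) := by
  set a : ℕ → ℝ≥0∞ := fun n => eLpNorm (g n) 2 (volume.restrict U) with ha_def
  set a₀ : ℝ≥0∞ := eLpNorm f 2 (volume.restrict U) with ha₀_def
  set d : ℕ → ℝ≥0∞ := fun n => eLpNorm (g n - f) 2 volume with hd_def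
  have ha₀ : a₀ ≠ ⊤ := (hf.restrict U).eLpNorm_ne_top
  have hgm : ∀ n, AEStronglyMeasurable (g n) (volume.restrict U) := fun n => (hg n).restrict
  have hfm : AEStronglyMeasurable f (volume.restrict U) := hf.1.restrict
  have hdres : ∀ n, eLpNorm (g n - f) 2 (volume.restrict U) ≤ d n := fun n =>
    eLpNorm_mono_measure _ Measure.restrict_le_self
  have hup : ∀ n, a n ≤ a₀ + d n := by
    intro n
    have h := eLpNorm_add_le hfm ((hgm n).sub hfm) (p := 2) (μ := volume.restrict U) (by norm_num)
    rw [add_sub_cancel] at h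
    exact h.trans (add_le_add le_rfl (hdres n))
  have hlow : ∀ n, a₀ ≤ a n + d n := by
    intro n
    have h := eLpNorm_sub_le (hgm n) ((hgm n).sub hfm) (p := 2) (μ := volume.restrict U) (by norm_num)
    rw [sub_sub_cancel] at h
    exact h.trans (add_le_add le_rfl (hdres n))
  have hconv : Tendsto a atTop (𝓝 a₀) := by
    refine tendsto_of_tendsto_of_tendsto_of_le_of_le (g := fun n => a₀ - d n) (h := fun n => a₀ + d n)
      ?_ ?_ (fun n => tsub_le_iff_right.2 (hlow n)) hup
    · have := ENNReal.Tendsto.sub (tendsto_const_nhds (x := a₀)) hlim (Or.inl ha₀)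
      rwa [tsub_zero] at this
    · have := (tendsto_const_nhds (x := a₀)).add hlim
      rwa [add_zero] at this
  simp_rw [setLIntegral_enorm_sq_eq]
  exact ((ENNReal.continuous_pow 2).tendsto a₀).comp hconv

end BoxFace

end Literature.MathematicalPhysics.QuantumManyBody.BoseGas

end
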